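import Summits.BirchSwinnertonDyer.BirchSwinnertonDyer.Theorems.BiquadraticEisensteinDescentEisensteinHeartFlatCMInertBadKPrimeBiquadraticCMField
import Summits.BirchSwinnertonDyer.BirchSwinnertonDyer.Theorems.BiquadraticEisensteinDescentEisensteinHeartFlatCMInertBadKPrimeBiquadraticExists
import Literature.NumberTheory.EllipticCurves.ComplexMultiplicationBurungaleFlachDescent
import Mathlib.FieldTheory.PrimitiveElement
import HarnessLib

set_option linter.dupNamespace false -- `Summit.BirchSwinnertonDyer.BirchSwinnertonDyer.Theorems.…` (summit = sub)
set_option autoImplicit false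

/-!
# Crux `EisensteinHeartFlatCMInertBadKPrime` (stmt-BirchSwinnertonDyer-21341), line `hsieh-lambda`, layer 2 —
# FRAME: the CM field realised INSIDE the biquadratic field, `K₁ := ℚ⟮x⟯ ⊆ L = K′(x)`, `x² = d_CM`

Route `BiquadraticEisensteinDescent` (cell `pub/bsd-wall`, width seat `bsd-wall-cm-bed-w1`; lead `bsd-wall-cm-bed-p1`,
skeleton `Cruxes/EisensteinHeartFlatCMInertBadKPrime/Lines/hsieh_lambda.lean` v2.1). THEOREMS ONLY (no definition, no named
fact, no `sorry`); supports stmt-BirchSwinnertonDyer-21341 as a helper; nothing about the crux's input (stub `V4`) or any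
case of BSD is asserted.

## Why this file

Every layer-2 file of the line speaks of the CM field `K_CM` as an abstract number field `K₁` WITH an algebra structure
`[Algebra K₁ L]` on the biquadratic field `L = K′ · K_CM` (`…KatzTypeInstantiation.exists_hT`: `[IsGalois K₁ L]`,
`IsImaginaryQuadratic K₁`, `∃ y ∈ K₁ ∖ K′`; `…DeuringOverKPrime.polynomial_identity` / `…KatzHsiehLValue`: `[Algebra K₁ L]
[IsGalois K₁ L] [IsGalois ℚ K₁]`, `c : K₁ ≃ₐ[ℚ] K₁`, `τ : L ≃ₐ[K′] L`, `hτc : (τ.restrictScalars ℚ).restrictNormal K₁ = c`;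
`…BranchRamification` / `…BranchBadPrimes`: `y ∈ 𝓞 K₁`, `y² = d`; and Deuring's fact itself:
`∀ K₁, IsCMFieldOfJ K₁ W.j → ∀ c ≠ 1, ∃ ψ …`), while the tree constructs `L` only as a quadratic extension of `K = K′` with a
square root `x` of `d = d_CM` (`…BiquadraticExists.exists_quadratic_sqrt`, `…BiquadraticPrimes.sqrt_not_mem_range`).
Rather than lifting an abstract `K_CM` into `L`, this file takes

  `K₁ := ℚ⟮x⟯ : IntermediateField ℚ L`   (Mathlib `IntermediateField.adjoin`; `Algebra ℚ⟮x⟯ L`, `IsScalarTower ℚ ℚ⟮x⟯ L`,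
                                          `NumberField ℚ⟮x⟯` are instances)

and proves everything the consumers ask of `K₁`, for `x ∉ K` with `x² = d ∈ ℤ` (and `[L : K] = 2`, `K` imaginary quadratic
where degrees over `ℚ` are needed):

* §1 `finrank_adjoin_eq_two` (`[ℚ⟮x⟯ : ℚ] = 2`), `gen_sq`, **`isCMFieldOfJ_adjoin`** (`IsCMFieldOfJ ℚ⟮x⟯ j` when
  `d = cmFieldDiscr j` — Deuring's fact applies to THIS `K₁`), `isTotallyComplex_adjoin`, `isImaginaryQuadratic_adjoin` (`d < 0`);
* §2 `finrank_adjoin_top_eq_two` (`[L : ℚ⟮x⟯] = 2`), `isGalois_adjoin_top` (`IsGalois ℚ⟮x⟯ L`), `isGalois_adjoin`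
  (`IsGalois ℚ ℚ⟮x⟯`), `exists_not_mem_range` (the `hgen` of `exists_hT`);
* §3 `isIntegral_of_sq_eq`, `exists_ringOfIntegers_sq_eq` (`y ∈ 𝓞 ℚ⟮x⟯`, `y² = d`, `y ↦ x`);
* §4 `smul_gen_eq_neg` (every `τ ≠ 1` in `Gal(L/K)` has `τ x = −x`), `exists_ne_one`, **`restrictNormal_gen`** /
  **`restrictNormal_ne_one`**: `c := (τ.restrictScalars ℚ).restrictNormal ℚ⟮x⟯` maps the generator to its negative, so `c ≠ 1`
  and `hτc` holds by `rfl` — the conjugation datum of Deuring's fact and of `polynomial_identity` at once.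

References: [NeukirchANT1999] Ch. I §2, Ch. IV §1; [Marcus2018] Ch. 2 Thm. 1; [SilvermanATAEC1994] App. A §3.
-/

noncomputable section

open scoped Classical NumberField IntermediateField
open NumberField IsDedekindDomain Module Polynomial IntermediateField

namespace Summit.BirchSwinnertonDyer.BirchSwinnertonDyer.Theorems.BiquadraticEisensteinDescentEisensteinHeartFlatCMInertBadKPrimeFrameCMSubfield

open Literature.NumberTheory.EllipticCurves
open Summit.BirchSwinnertonDyer.BirchSwinnertonDyer.Theorems.BiquadraticEisensteinDescentEisensteinHeartFlatCMInertBadKPrimeBiquadraticCMField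
open Summit.BirchSwinnertonDyer.BirchSwinnertonDyer.Theorems.BiquadraticEisensteinDescentEisensteinHeartFlatCMInertBadKPrimeBiquadraticExists

variable {K L : Type} [Field K] [NumberField K] [Field L] [NumberField L] [Algebra K L]

/-! ### §1 The subfield `ℚ⟮x⟯` generated by a square root of an integer is quadratic -/

/-- An element outside `K` is outside `ℚ` (inside `L ⊇ K ⊇ ℚ`). [folklore] -/
theorem not_mem_range_rat {x : L} (hxK : x ∉ Set.range (algebraMap K L)) : x ∉ Set.range (algebraMap ℚ L) := by
  rintro ⟨q, hq⟩
  exact hxK ⟨algebraMap ℚ K q, by rw [← IsScalarTower.algebraMap_apply, hq]⟩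

/-- **The minimal polynomial of `x ∉ ℚ` with `x² = d` has degree `2`.** [cite: Marcus2018, Ch. 2 Thm. 1] -/
theorem natDegree_minpoly_eq_two {x : L} {d : ℤ} (hx : x ^ 2 = (d : L)) (hxQ : x ∉ Set.range (algebraMap ℚ L)) :
    (minpoly ℚ x).natDegree = 2 := by
  have hint : IsIntegral ℚ x := Algebra.IsIntegral.isIntegral x
  have hle : (minpoly ℚ x).natDegree ≤ 2 := by
    have hp : (X ^ 2 - C (d : ℚ) : ℚ[X]) ≠ 0 := (monic_X_pow_sub_C _ two_ne_zero).ne_zero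
    have hroot : aeval x (X ^ 2 - C (d : ℚ) : ℚ[X]) = 0 := by
      simp [hx]
    have h := minpoly.degree_le_of_ne_zero ℚ x hp hroot
    rw [degree_eq_natDegree (minpoly.ne_zero hint), degree_eq_natDegree hp, natDegree_X_pow_sub_C] at h
    exact_mod_cast h
  have hpos : 0 < (minpoly ℚ x).natDegree := minpoly.natDegree_pos hint
  have hne1 : (minpoly ℚ x).natDegree ≠ 1 := by
    intro h1
    have hdeg : (minpoly ℚ x).degree = 1 := by rw [degree_eq_natDegree (minpoly.ne_zero hint), h1]; rfl
    exact hxQ (Set.mem_range.mpr (RingHom.mem_range.mp ((minpoly.degree_eq_one_iff).mp hdeg)))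
  omega

/-- **`[ℚ⟮x⟯ : ℚ] = 2`** for `x ∉ ℚ` with `x² = d ∈ ℤ`. [cite: Marcus2018, Ch. 2 Thm. 1] -/
theorem finrank_adjoin_eq_two {x : L} {d : ℤ} (hx : x ^ 2 = (d : L)) (hxQ : x ∉ Set.range (algebraMap ℚ L)) :
    finrank ℚ ℚ⟮x⟯ = 2 := by
  rw [adjoin.finrank (Algebra.IsIntegral.isIntegral x), natDegree_minpoly_eq_two hx hxQ]

/-- The generator as an element of `ℚ⟮x⟯` squares to `d`. [folklore] -/
theorem gen_sq {x : L} {d : ℤ} (hx : x ^ 2 = (d : L)) :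
    (AdjoinSimple.gen ℚ x) ^ 2 = (d : ℚ⟮x⟯) := by
  apply Subtype.ext
  rw [SubmonoidClass.coe_pow, AdjoinSimple.coe_gen, hx]
  simp

/-- **`ℚ⟮x⟯` IS the CM field** in the sense of `IsCMFieldOfJ` when `x² = cmFieldDiscr j` (`x ∉ ℚ`): `[ℚ⟮x⟯ : ℚ] = 2` and
`d_K = cmFieldDiscr j` is a square in it — so Deuring's `Deuring_exists_heckeCharacter_of_maximalCM` applies to `K₁ := ℚ⟮x⟯`,
a subfield of `L` (no embedding to construct). [cite: SilvermanATAEC1994, App. A §3 (first table)] -/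
theorem isCMFieldOfJ_adjoin {x : L} {j : ℚ} (hx : x ^ 2 = (cmFieldDiscr j : L)) (hxQ : x ∉ Set.range (algebraMap ℚ L)) :
    IsCMFieldOfJ ℚ⟮x⟯ j :=
  ⟨finrank_adjoin_eq_two hx hxQ, ⟨AdjoinSimple.gen ℚ x, gen_sq hx⟩⟩

/-- **`ℚ⟮x⟯` is totally complex** when `x² = d < 0`: a real place would give a real square root of `d`.
[cite: NeukirchANT1999, Ch. III §1] -/
theorem isTotallyComplex_adjoin {x : L} {d : ℤ} (hx : x ^ 2 = (d : L)) (hd : d < 0) :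
    IsTotallyComplex ℚ⟮x⟯ := by
  refine ⟨fun w ↦ ?_⟩
  rw [← InfinitePlace.not_isReal_iff_isComplex]
  intro hw
  obtain ⟨φ, hφ, -⟩ := hw
  -- `φ(x)` is a real number with square `d < 0`
  have hreal : starRingEnd ℂ (φ (AdjoinSimple.gen ℚ x)) = φ (AdjoinSimple.gen ℚ x) := by
    have := RingHom.congr_fun (ComplexEmbedding.isReal_iff.mp hφ) (AdjoinSimple.gen ℚ x)
    simpa using this
  have hsq : (φ (AdjoinSimple.gen ℚ x)) ^ 2 = (d : ℂ) := by
    rw [← map_pow, gen_sq hx, map_intCast]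
  obtain ⟨r, hr⟩ : ∃ r : ℝ, (r : ℂ) = φ (AdjoinSimple.gen ℚ x) := Complex.conj_eq_iff_real.mp hreal |>.imp fun r h ↦ h.symm
  have h1 : ((r ^ 2 : ℝ) : ℂ) = (d : ℂ) := by rw [Complex.ofReal_pow, hr, hsq]
  have h2 : r ^ 2 = (d : ℝ) := by exact_mod_cast h1
  have h3 : (0 : ℝ) ≤ r ^ 2 := sq_nonneg r
  have h4 : ((d : ℤ) : ℝ) < 0 := by exact_mod_cast hd
  linarith

/-- `ℚ⟮x⟯` is imaginary quadratic (`x ∉ ℚ`, `x² = d < 0`). [cite: NeukirchANT1999, Ch. III §1] -/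
theorem isImaginaryQuadratic_adjoin {x : L} {d : ℤ} (hx : x ^ 2 = (d : L)) (hd : d < 0)
    (hxQ : x ∉ Set.range (algebraMap ℚ L)) : IsImaginaryQuadratic ℚ⟮x⟯ :=
  ⟨finrank_adjoin_eq_two hx hxQ, isTotallyComplex_adjoin hx hd⟩

/-! ### §2 `ℚ⟮x⟯` inside the quadratic extension `L/K`: degrees, Galois, `x ∉ K` -/

/-- **`[L : ℚ⟮x⟯] = 2`** when `K` is imaginary quadratic, `[L : K] = 2` and `x ∉ ℚ`, `x² = d` (`4 = 2 · [L : ℚ⟮x⟯]`).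
[cite: NeukirchANT1999, Ch. I §2] -/
theorem finrank_adjoin_top_eq_two (hK : IsImaginaryQuadratic K) (h2 : finrank K L = 2) {x : L} {d : ℤ}
    (hx : x ^ 2 = (d : L)) (hxQ : x ∉ Set.range (algebraMap ℚ L)) : finrank ℚ⟮x⟯ L = 2 := by
  have h4 := finrank_eq_four hK h2
  have ht := Module.finrank_mul_finrank ℚ ℚ⟮x⟯ L
  rw [h4, finrank_adjoin_eq_two hx hxQ] at ht
  omega

/-- `L/ℚ⟮x⟯` is Galois (quadratic). [cite: NeukirchANT1999, Ch. IV §1] -/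
theorem isGalois_adjoin_top (hK : IsImaginaryQuadratic K) (h2 : finrank K L = 2) {x : L} {d : ℤ}
    (hx : x ^ 2 = (d : L)) (hxQ : x ∉ Set.range (algebraMap ℚ L)) : IsGalois ℚ⟮x⟯ L :=
  isGalois_of_finrank_eq_two (finrank_adjoin_top_eq_two hK h2 hx hxQ)

/-- `ℚ⟮x⟯/ℚ` is Galois (quadratic). [cite: NeukirchANT1999, Ch. IV §1] -/
theorem isGalois_adjoin {x : L} {d : ℤ} (hx : x ^ 2 = (d : L)) (hxQ : x ∉ Set.range (algebraMap ℚ L)) :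
    IsGalois ℚ ℚ⟮x⟯ := by
  haveI : Algebra.IsQuadraticExtension ℚ ℚ⟮x⟯ := { finrank_eq_two' := finrank_adjoin_eq_two hx hxQ }
  infer_instance

omit [NumberField K] in
/-- **`ℚ⟮x⟯ ⊄ K` inside `L`** (the hypothesis `hgen` of `…KatzTypeInstantiation.exists_hT`): the generator maps to `x ∉ K`.
[folklore] -/
theorem exists_not_mem_range {x : L} (hxK : x ∉ Set.range (algebraMap K L)) :
    ∃ y : ℚ⟮x⟯, algebraMap ℚ⟮x⟯ L y ∉ Set.range (algebraMap K L) :=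
  ⟨AdjoinSimple.gen ℚ x, by rwa [IntermediateField.algebraMap_apply, AdjoinSimple.coe_gen]⟩

/-! ### §3 Integrality: `x ∈ 𝓞_L`, `√d ∈ 𝓞_{ℚ⟮x⟯}` -/

omit [NumberField L] in
/-- A square root of an integer is an algebraic integer. [folklore] -/
theorem isIntegral_of_sq_eq {x : L} {d : ℤ} (hx : x ^ 2 = (d : L)) : IsIntegral ℤ x := by
  refine IsIntegral.of_pow two_pos ?_
  rw [hx]
  exact isIntegral_algebraMap (R := ℤ) (A := L) (x := d) |> fun h ↦ by simpa using h

/-- **`√d ∈ 𝓞_{ℚ⟮x⟩}` with square `d`** — the `y ∈ 𝓞 K₁`, `y² = d` of `…BranchRamification` / `…BiquadraticPrimes` at `K₁ = ℚ⟮x⟯`,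
mapping to `x` in `L`. [folklore] -/
theorem exists_ringOfIntegers_sq_eq {x : L} {d : ℤ} (hx : x ^ 2 = (d : L)) :
    ∃ y : 𝓞 ℚ⟮x⟯, y ^ 2 = (d : 𝓞 ℚ⟮x⟯) ∧ ((y : ℚ⟮x⟯) : L) = x := by
  have hint : IsIntegral ℤ (AdjoinSimple.gen ℚ x) := by
    refine IsIntegral.of_pow two_pos ?_
    rw [gen_sq hx]
    simpa using isIntegral_algebraMap (R := ℤ) (A := ℚ⟮x⟯) (x := d)
  refine ⟨⟨AdjoinSimple.gen ℚ x, hint⟩, ?_, rfl⟩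
  apply Subtype.ext
  change (AdjoinSimple.gen ℚ x) ^ 2 = ((d : 𝓞 ℚ⟮x⟯) : ℚ⟮x⟯)
  rw [gen_sq hx]
  simp

/-! ### §4 The Galois datum: the non-trivial `K`-automorphism of `L` negates `x`; the induced conjugation of `ℚ⟮x⟯` -/

/-- **Every `τ ≠ 1` in `Gal(L/K)` sends `x ↦ −x`** (`[L : K] = 2`, `x ∉ K`, `x² = d`): `τ x = ±x` as a root of `X² − d`,
and `τ x = x` would make `x` fixed by all of `Gal(L/K) = {1, τ}`, i.e. `x ∈ K` (`IsGalois.mem_range_algebraMap_iff_fixed`).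
[cite: NeukirchANT1999, Ch. IV §1] -/
theorem smul_gen_eq_neg (h2 : finrank K L = 2) {x : L} {d : ℤ} (hx : x ^ 2 = (d : L))
    (hxK : x ∉ Set.range (algebraMap K L)) (τ : L ≃ₐ[K] L) (hτ : τ ≠ 1) : τ x = -x := by
  haveI : IsGalois K L := isGalois_of_finrank_eq_two h2
  -- `τ x = x` or `τ x = -x`
  have hsq : (τ x) ^ 2 = x ^ 2 := by rw [← map_pow, hx, map_intCast]
  rcases sq_eq_sq_iff_eq_or_eq_neg.mp hsq with h | h
  · -- then `x` is fixed by every automorphism (`Gal = {1, τ}`), contradiction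
    exfalso
    apply hxK
    have hcard : Nat.card (L ≃ₐ[K] L) = 2 := by rw [IsGalois.card_aut_eq_finrank, h2]
    obtain ⟨a, b, -, huniv⟩ := Nat.card_eq_two_iff.mp hcard
    have mem : ∀ g : L ≃ₐ[K] L, g = a ∨ g = b := fun g ↦ by
      have hg : g ∈ ({a, b} : Set (L ≃ₐ[K] L)) := by rw [huniv]; exact Set.mem_univ g
      simpa using hg
    refine (IsGalois.mem_range_algebraMap_iff_fixed x).mpr fun g ↦ ?_
    by_cases hg : g = 1
    · rw [hg, AlgEquiv.one_apply]
    · have hgτ : g = τ := by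
        by_contra hne
        rcases mem 1 with h1 | h1 <;> rcases mem τ with ht | ht <;> rcases mem g with hg2 | hg2 <;>
          first
          | exact hτ (ht.trans h1.symm)
          | exact hg (hg2.trans h1.symm)
          | exact hne (hg2.trans ht.symm)
      rw [hgτ, h]
  · exact h

omit [NumberField K] in
/-- `−x ≠ x` for `x ∉ K` (so `x ≠ 0`; characteristic `0`). [folklore] -/
theorem neg_ne_self_of_not_mem_range {x : L} (hxK : x ∉ Set.range (algebraMap K L)) : -x ≠ x := by
  intro h
  have h2 : (2 : L) * x = 0 := by linear_combination -h
  exact Literature.NumberTheory.QuadraticFields.Quadratic.ne_zero_of_not_mem_range hxK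
    ((mul_eq_zero.mp h2).resolve_left two_ne_zero)

/-- `Gal(L/K)` has a non-trivial element (`[L : K] = 2`). [cite: NeukirchANT1999, Ch. IV §1] -/
theorem exists_ne_one (h2 : finrank K L = 2) : ∃ τ : L ≃ₐ[K] L, τ ≠ 1 := by
  haveI : IsGalois K L := isGalois_of_finrank_eq_two h2
  have hcard : Nat.card (L ≃ₐ[K] L) = 2 := by rw [IsGalois.card_aut_eq_finrank, h2]
  obtain ⟨a, b, hab, -⟩ := Nat.card_eq_two_iff.mp hcard
  by_cases ha : a = 1
  · exact ⟨b, fun hb ↦ hab (ha.trans hb.symm)⟩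
  · exact ⟨a, ha⟩

/-- **The conjugation of `K₁ = ℚ⟮x⟯` induced by `τ ∈ Gal(L/K) ∖ {1}`**: `c := (τ|_ℚ).restrictNormal ℚ⟮x⟯` sends the generator
`x ↦ −x` — so `c ≠ 1` and `(τ.restrictScalars ℚ).restrictNormal ℚ⟮x⟯ = c` holds by definition (the data `c`, `τ`, `hτc` of
`…DeuringOverKPrime.polynomial_identity`; Deuring's fact is then invoked at `(K₁, c)`). [cite: NeukirchANT1999, Ch. IV §1] -/
theorem restrictNormal_gen (h2 : finrank K L = 2) {x : L} {d : ℤ} (hx : x ^ 2 = (d : L))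
    (hxK : x ∉ Set.range (algebraMap K L)) (τ : L ≃ₐ[K] L) (hτ : τ ≠ 1) :
    haveI := isGalois_adjoin hx (not_mem_range_rat hxK)
    (τ.restrictScalars ℚ).restrictNormal ℚ⟮x⟯ (AdjoinSimple.gen ℚ x) = -AdjoinSimple.gen ℚ x := by
  haveI := isGalois_adjoin hx (not_mem_range_rat hxK)
  apply (algebraMap ℚ⟮x⟯ L).injective
  rw [AlgEquiv.restrictNormal_commutes, map_neg, IntermediateField.algebraMap_apply, AdjoinSimple.coe_gen]
  exact smul_gen_eq_neg h2 hx hxK τ hτ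

/-- … hence `c ≠ 1`. [cite: NeukirchANT1999, Ch. IV §1] -/
theorem restrictNormal_ne_one (h2 : finrank K L = 2) {x : L} {d : ℤ} (hx : x ^ 2 = (d : L))
    (hxK : x ∉ Set.range (algebraMap K L)) (τ : L ≃ₐ[K] L) (hτ : τ ≠ 1) :
    haveI := isGalois_adjoin hx (not_mem_range_rat hxK)
    (τ.restrictScalars ℚ).restrictNormal ℚ⟮x⟯ ≠ 1 := by
  haveI := isGalois_adjoin hx (not_mem_range_rat hxK)
  intro h
  have h1 := restrictNormal_gen h2 hx hxK τ hτ
  rw [h, AlgEquiv.one_apply] at h1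
  have h2' : ((AdjoinSimple.gen ℚ x : ℚ⟮x⟯) : L) = ((-AdjoinSimple.gen ℚ x : ℚ⟮x⟯) : L) := congrArg _ h1
  rw [NegMemClass.coe_neg, AdjoinSimple.coe_gen] at h2'
  exact neg_ne_self_of_not_mem_range hxK h2'.symm

end Summit.BirchSwinnertonDyer.BirchSwinnertonDyer.Theorems.BiquadraticEisensteinDescentEisensteinHeartFlatCMInertBadKPrimeFrameCMSubfield

end
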